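/-
Copyright (c) 2026 the pub-hodgecm-mathlib formalisation cell (harness21).  Prover seat hodgecm-mathlib-K2E4-p11 (g8): Track B «K2-LIT»,
#184♮ = hLiu418 = stmt-HodgeConjecture-24832; socket #41 open surface (u-0c), I4 block (desk of record): ★ p862505 `exists_level_letters` (K2Liu-p12) WITH A
PRESCRIBED NEIGHBOURHOOD — the letter `hlevKG` of I3 ED. 2 ∕ I4 ED. 5 (proof = K2Liu-p12's §4 verbatim with one more intersection; credit K2Liu-p12).
THEOREMS ONLY (no `def`, no `instance`, no `notation`, no named-fact hypothesis, no `sorry`).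
-/
import Summits.HodgeConjecture.HodgeConjecture.Theorems.K2LiuSiegelLeviArchPart   -- ★ p862552 (K2Liu-p12): `archPart_eq_one_of_blk_eq_levi` (+ ★ p862505 `K2LiuSiegelMiddleTermLevelLetters` §1–§3 by import)
import HarnessLib

/-!
# Crux `HLiu418`, socket #41, (u-0c) I4 block — `K2LiuSiegelMiddleTermLevelLettersNhds`: THE LEVEL LETTERS OF THE MIDDLE-TERM DATUM INSIDE A PRESCRIBED NEIGHBOURHOOD OF `1`

Cell `hodgecm-mathlib`, crux item hLiu418 = `stmt-HodgeConjecture-24832`; squad K2 ∕ K2Liu (L1, LEAD F0P6-plan (g14)), road `K2_Liu`, socket #41, (u-0c) I4 block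
(K2E4-p11 desk of record; consumers: I3 ED. 2 `K2LiuSiegelMiddleTermKTypesLevel` (K2Liu-p12, binder `hlevKG`) and I4 ED. 5 `K2LiuSiegelEisensteinMiddleTermOfStandardLevel`).
Lane `--supports stmt-HodgeConjecture-24832 --as helper` (count-neutral helper; closes no socket by itself).

THE MATHEMATICS [BorelJacquet1979, §1.1, §4.1], [PlatonovRapinchuk1994, §5.1], [NeukirchANT1999, VII §6 (6.11)].  ★ p862505 `exists_level_letters` produces ONE principal
congruence level `(S, γl)` of `GL_n(𝒪̂_L)` inside the intersection of two neighbourhoods of `1` (the conductor of `χ ∘ det` and the preimage of Lemma K-f's open `U_f`);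
the same proof with a THIRD neighbourhood `W₀ ∈ 𝓝 1` folded in gives a level that moreover lies in `W₀` — at I4 ED. 5, `W₀ := {r | (1, r) ∈ KG}` for the open finite-index
`KG ≤ K_{GL₂}` of the preimage-level cut (RULING M-158j (R-a)), whence `hlevKG : (1, r) ∈ KG` on the level.
* §1 **`exists_level_letters_of_nhds`** (K2Liu-p12's §4 with `W₀`; `hΛ1` by value), §2 **`exists_level_letters_of_blk_of_nhds`** (`hΛ1` discharged for the chart's Levi
  homomorphism by ★ p862552 `archPart_eq_one_of_blk_eq_levi`).
HONEST LABEL.  Count-neutral helper; it retires nothing by itself: `HC_CM` is proved only modulo the 7 printed citations (2 remaining named inputs: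
hLiu418 = `stmt-HodgeConjecture-24832`, h413 = `stmt-HodgeConjecture-24833`) until rung 0 closes.

## References
* [BorelJacquet1979] A. Borel, H. Jacquet, *Automorphic forms and automorphic representations*, PSPM 33.1 (1979), §1.1, §4.1.
* [PlatonovRapinchuk1994] V. Platonov, A. Rapinchuk, *Algebraic Groups and Number Theory* (1994), §5.1.
* [NeukirchANT1999] J. Neukirch, *Algebraic Number Theory* (1999), VII §6 (6.11).
* [Tan1999] V. Tan, Canad. J. Math. 51 (1999), §1 p. 166.
-/

set_option autoImplicit false
set_option linter.dupNamespace false -- the mandated namespace repeats `HodgeConjecture.HodgeConjecture`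

noncomputable section

open scoped Matrix Topology
open NumberField IsDedekindDomain Set Filter ValuativeRel
open Literature.NumberTheory.Automorphic Literature.NumberTheory.GaloisRepresentations
open Literature.NumberTheory.GelbartRogawski1991 Literature.NumberTheory.GelbartRogawski1991.GRConstruction
open Literature.NumberTheory.GelbartRogawski1991.AdaptedBlocks
open Literature.NumberTheory.K2Lit.SiegelDoubled
open Summit.HodgeConjecture.HodgeConjecture.Cruxes.HLiu418.K2LiuSiegelMiddleTermLevelLetters (exists_level_subset_of_mem_nhds_one
  exists_nhds_one_forall_heckeCharacter_det_eq_one exists_isOpen_forall_rightTranslateSpan_mul_eq)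
open Summit.HodgeConjecture.HodgeConjecture.Cruxes.HLiu418.K2LiuSiegelLeviArchPart (archPart_eq_one_of_blk_eq_levi)

namespace Summit.HodgeConjecture.HodgeConjecture.Cruxes.HLiu418.K2LiuSiegelMiddleTermLevelLettersNhds

/-! ## §1 The level letters inside a prescribed neighbourhood (`hΛ1` by value) -/

section Main

variable {L : Type} [Field L] [NumberField L] [IsCMField L]
variable {N M n : ℕ} {e : Fin N × Fin M ≃ Fin n}
  {dV : Fin N → L} {hdV : ∀ i, IsCMField.complexConj L (dV i) = dV i}
  {dW : Fin M → L} {hdW : ∀ i, IsCMField.complexConj L (dW i) = dW i}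

/-- **THE LEVEL LETTERS INSIDE A PRESCRIBED NEIGHBOURHOOD `W₀` OF `1`** (★ p862505 `exists_level_letters`, K2Liu-p12, with ONE more neighbourhood folded into the
intersection): for a STANDARD `𝒦`, a continuous `𝒦.K`-finite `φ`, a Hecke character `χ`, a continuous `Λ : GL_n(𝔸_L) →* H(𝔸)` with `(Λ(1,r))_∞ = 1`, and `W₀ ∈ 𝓝 1` in
`GL_n(𝔸_L^∞)`: ONE level `(S, γl)` (`0 ≠ γ_v < 1`) such that every `r ∈ GL_n(𝒪̂_L)` with `r_v ∈ K_v(γ_v)` (`v ∈ S`) lies in `W₀`, has `χ(det(1,r)) = 1`, and `Λ(1,r) ∈ U` for ONE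
subgroup `U ≤ H(𝔸)` normalised by `𝒦.K` under which `φ` is right-invariant (§1 of ★ p862505 applied to `W₀ ∩ W₁ ∩ W₂`; the rest of K2Liu-p12's proof verbatim).
[cite: BorelJacquet1979, §1.1, §4.1] [cite: Tan1999, §1 p. 166] [cite: NeukirchANT1999, VII §6 (6.11)] [cite: PlatonovRapinchuk1994, §5.1] -/
theorem exists_level_letters_of_nhds {𝒦 : IwasawaDatum L e dV hdV dW hdW} (h𝒦 : 𝒦.IsStd)
    (φ : HA L e dV hdV dW hdW → ℂ) (hφ : Literature.NumberTheory.K2Lit.SiegelDoubled.IsKFinite 𝒦 φ) (hφc : Continuous φ) (χ : HeckeCharacter L)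
    (Λ : GL (Fin n) (AdeleRing (𝓞 L) L) →* HA L e dV hdV dW hdW) (hΛc : Continuous Λ)
    (hΛ1 : ∀ r : GL (Fin n) (FiniteAdeleRing (𝓞 L) L),
      UnitaryGroup.archPart (Fp L) L (IsCMField.complexConj L) (n + n) (hermD L e dV hdV dW hdW) (Λ (GLn.ofFinite n L r)) = 1)
    (W₀ : Set (GL (Fin n) (FiniteAdeleRing (𝓞 L) L))) (hW₀ : W₀ ∈ 𝓝 (1 : GL (Fin n) (FiniteAdeleRing (𝓞 L) L))) :
    ∃ (S : Finset (HeightOneSpectrum (𝓞 L))) (γl : ∀ v : HeightOneSpectrum (𝓞 L), ValuativeRel.ValueGroupWithZero (v.adicCompletion L)),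
      (∀ v ∈ S, γl v ≠ 0) ∧ (∀ v ∈ S, γl v < 1) ∧
      (∀ r : GL (Fin n) (FiniteAdeleRing (𝓞 L) L), r ∈ glFiniteIntegralLevel n L → (∀ v ∈ S, GLn.evalAt n L v r ∈ congruenceGL n (γl v)) → r ∈ W₀) ∧
      (∀ r : GL (Fin n) (FiniteAdeleRing (𝓞 L) L), r ∈ glFiniteIntegralLevel n L → (∀ v ∈ S, GLn.evalAt n L v r ∈ congruenceGL n (γl v)) →
        χ (Matrix.GeneralLinearGroup.det (GLn.ofFinite n L r)) = 1) ∧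
      ∃ U : Subgroup (HA L e dV hdV dW hdW),
        (∀ k ∈ 𝒦.K, ∀ u ∈ U, k⁻¹ * u * k ∈ U) ∧
        (∀ (g : HA L e dV hdV dW hdW), ∀ u ∈ U, φ (g * u) = φ g) ∧
        ∀ r : GL (Fin n) (FiniteAdeleRing (𝓞 L) L), r ∈ glFiniteIntegralLevel n L → (∀ v ∈ S, GLn.evalAt n L v r ∈ congruenceGL n (γl v)) →
          Λ (GLn.ofFinite n L r) ∈ U := by
  -- §3: one open `U_f` fixing every vector of `V`
  obtain ⟨Uf, hUfo, hinv⟩ := exists_isOpen_forall_rightTranslateSpan_mul_eq (n := n) h𝒦 hφ hφc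
  -- the open preimage `W₁ = {r | (Λ(1,r))_f ∈ U_f}` and §2's neighbourhood `W₂`
  have hW₁o : IsOpen {r : GL (Fin n) (FiniteAdeleRing (𝓞 L) L) |
      UnitaryGroup.finPart (Fp L) L (IsCMField.complexConj L) (n + n) (hermD L e dV hdV dW hdW) (Λ (GLn.ofFinite n L r)) ∈ Uf} :=
    hUfo.preimage ((UnitaryGroup.continuous_finPart (Fp L) L (IsCMField.complexConj L) (n + n) (hermD L e dV hdV dW hdW)).comp
      (hΛc.comp (GLn.continuous_ofFinite (n := n) (K := L))))
  have hW₁1 : (1 : GL (Fin n) (FiniteAdeleRing (𝓞 L) L)) ∈ {r : GL (Fin n) (FiniteAdeleRing (𝓞 L) L) |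
      UnitaryGroup.finPart (Fp L) L (IsCMField.complexConj L) (n + n) (hermD L e dV hdV dW hdW) (Λ (GLn.ofFinite n L r)) ∈ Uf} := by
    have h1 : UnitaryGroup.finPart (Fp L) L (IsCMField.complexConj L) (n + n) (hermD L e dV hdV dW hdW) (1 : HA L e dV hdV dW hdW) = 1 := map_one _
    rw [Set.mem_setOf_eq, map_one, map_one, h1]
    exact Uf.one_mem
  obtain ⟨W₂, hW₂, hχW⟩ := exists_nhds_one_forall_heckeCharacter_det_eq_one (n := n) χ
  -- §1 on `W₁ ∩ W₂`
  obtain ⟨S, γl, hγ0, hγ1, hlev⟩ := exists_level_subset_of_mem_nhds_one (Filter.inter_mem (Filter.inter_mem (hW₁o.mem_nhds hW₁1) hW₂) hW₀)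
  refine ⟨S, γl, hγ0, hγ1, fun r hr hrS => (hlev r hr hrS).2, fun r hr hrS => hχW r (hlev r hr hrS).1.2,
    { carrier := {u | ∀ c ∈ 𝒦.K, ∀ g : HA L e dV hdV dW hdW, φ (g * (c⁻¹ * u * c)) = φ g}
      mul_mem' := ?_
      one_mem' := ?_
      inv_mem' := ?_ }, ?_, ?_, ?_⟩
  · intro u u' hu hu' c hc g
    have key : g * (c⁻¹ * (u * u') * c) = g * (c⁻¹ * u * c) * (c⁻¹ * u' * c) := by group
    show φ (g * (c⁻¹ * (u * u') * c)) = φ g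
    rw [key, hu' c hc, hu c hc]
  · intro c _ g
    show φ (g * (c⁻¹ * 1 * c)) = φ g
    rw [mul_one, inv_mul_cancel, mul_one]
  · intro u hu c hc g
    have key : g * (c⁻¹ * u⁻¹ * c) * (c⁻¹ * u * c) = g := by group
    have h := hu c hc (g * (c⁻¹ * u⁻¹ * c))
    rw [key] at h
    show φ (g * (c⁻¹ * u⁻¹ * c)) = φ g
    exact h.symm
  · -- hUK
    intro k hk u hu c hc g
    have h := hu (k * c) (𝒦.K.mul_mem hk hc) g
    have key : g * (c⁻¹ * (k⁻¹ * u * k) * c) = g * ((k * c)⁻¹ * u * (k * c)) := by group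
    show φ (g * (c⁻¹ * (k⁻¹ * u * k) * c)) = φ g
    rw [key, h]
  · -- hfU
    intro g u hu
    have h := hu 1 𝒦.K.one_mem g
    rwa [inv_one, one_mul, mul_one] at h
  · -- hΛU
    intro r hr hrS c hc g
    have hfin := (hlev r hr hrS).1.1
    rw [Set.mem_setOf_eq] at hfin
    have hψ : (fun x => φ (x * c)) ∈ rightTranslateSpan 𝒦 φ := rightTranslate_mem_rightTranslateSpan 𝒦 φ hc
    have key := hinv _ hψ (Λ (GLn.ofFinite n L r)) (hΛ1 r) hfin (g * c⁻¹)
    rw [inv_mul_cancel_right] at key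
    show φ (g * (c⁻¹ * Λ (GLn.ofFinite n L r) * c)) = φ g
    rw [← key]
    congr 1
    group

end Main

/-! ## §2 The same over the chart letter `hΛ` -/

section Levi

variable (L : Type) [Field L] [NumberField L] [IsCMField L]
variable {N M n : ℕ} (e : Fin N × Fin M ≃ Fin n)
  (dV : Fin N → L) (hdV : ∀ i, IsCMField.complexConj L (dV i) = dV i)
  (dW : Fin M → L) (hdW : ∀ i, IsCMField.complexConj L (dW i) = dW i)

/-- **THE LEVEL LETTERS INSIDE `W₀` FOR THE CHART's LEVI HOMOMORPHISM** (`hΛ1` discharged by ★ p862552 `archPart_eq_one_of_blk_eq_levi`): the one line I4 ED. 5 calls.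
[cite: BorelJacquet1979, §1.1, §4.1] [cite: Tan1999, §1 p. 166] [cite: NeukirchANT1999, VII §6 (6.11)] -/
theorem exists_level_letters_of_blk_of_nhds (hdV0 : ∀ i, dV i ≠ 0) (hdW0 : ∀ i, dW i ≠ 0) {𝒦 : IwasawaDatum L e dV hdV dW hdW} (h𝒦 : 𝒦.IsStd)
    (φ : HA L e dV hdV dW hdW → ℂ) (hφ : Literature.NumberTheory.K2Lit.SiegelDoubled.IsKFinite 𝒦 φ) (hφc : Continuous φ) (χ : HeckeCharacter L)
    (Λ : GL (Fin n) (AdeleRing (𝓞 L) L) →* HA L e dV hdV dW hdW)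
    (hΛ : ∀ g : GL (Fin n) (AdeleRing (𝓞 L) L), blk L e dV hdV dW hdW (Λ g) =
      cayR (AdeleRing (𝓞 L) L) (Fin n) * Matrix.fromBlocks (g : Matrix (Fin n) (Fin n) (AdeleRing (𝓞 L) L)) 0 0
        (((gramR L e dV hdV dW hdW).map ((algebraMap L (AdeleRing (𝓞 L) L)).comp (algebraMap (Fp L) L)))⁻¹ *
          (((g⁻¹ : GL (Fin n) (AdeleRing (𝓞 L) L)) : Matrix (Fin n) (Fin n) (AdeleRing (𝓞 L) L)).map
            (UnitaryGroup.conjAdele (Fp L) L (IsCMField.complexConj L)))ᵀ *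
          (gramR L e dV hdV dW hdW).map ((algebraMap L (AdeleRing (𝓞 L) L)).comp (algebraMap (Fp L) L))) *
        cayRinv (AdeleRing (𝓞 L) L) (Fin n))
    (hΛc : Continuous Λ) (W₀ : Set (GL (Fin n) (FiniteAdeleRing (𝓞 L) L))) (hW₀ : W₀ ∈ 𝓝 (1 : GL (Fin n) (FiniteAdeleRing (𝓞 L) L))) :
    ∃ (S : Finset (HeightOneSpectrum (𝓞 L))) (γl : ∀ v : HeightOneSpectrum (𝓞 L), ValuativeRel.ValueGroupWithZero (v.adicCompletion L)),
      (∀ v ∈ S, γl v ≠ 0) ∧ (∀ v ∈ S, γl v < 1) ∧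
      (∀ r : GL (Fin n) (FiniteAdeleRing (𝓞 L) L), r ∈ glFiniteIntegralLevel n L → (∀ v ∈ S, GLn.evalAt n L v r ∈ congruenceGL n (γl v)) → r ∈ W₀) ∧
      (∀ r : GL (Fin n) (FiniteAdeleRing (𝓞 L) L), r ∈ glFiniteIntegralLevel n L → (∀ v ∈ S, GLn.evalAt n L v r ∈ congruenceGL n (γl v)) →
        χ (Matrix.GeneralLinearGroup.det (GLn.ofFinite n L r)) = 1) ∧
      ∃ U : Subgroup (HA L e dV hdV dW hdW),
        (∀ k ∈ 𝒦.K, ∀ u ∈ U, k⁻¹ * u * k ∈ U) ∧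
        (∀ (g : HA L e dV hdV dW hdW), ∀ u ∈ U, φ (g * u) = φ g) ∧
        ∀ r : GL (Fin n) (FiniteAdeleRing (𝓞 L) L), r ∈ glFiniteIntegralLevel n L → (∀ v ∈ S, GLn.evalAt n L v r ∈ congruenceGL n (γl v)) →
          Λ (GLn.ofFinite n L r) ∈ U :=
  exists_level_letters_of_nhds h𝒦 φ hφ hφc χ Λ hΛc (fun r => archPart_eq_one_of_blk_eq_levi L e dV hdV dW hdW hdV0 hdW0 r (hΛ (GLn.ofFinite n L r))) W₀ hW₀

end Levi

end Summit.HodgeConjecture.HodgeConjecture.Cruxes.HLiu418.K2LiuSiegelMiddleTermLevelLettersNhds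

end
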